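import Literature.Barriers.Parity.SiegelZeroDichotomyPairHLProp71
import Literature.Barriers.Parity.SiegelZeroDichotomyPairHLSieveExpansion
import HarnessLib

/-!
# Tao–Teräväinen 2022, Proposition 7.1 (ii) (`k = 2` chain): `Λ♭_Siegel` in progressions

Topic `Literature/Barriers/Parity`, sub-namespace `TaoTeravainen`; a file of the proof DAG of
`Literature.Barriers.Parity.TaoTeravainen2021_prop72_81_pair` (T. Tao, J. Teräväinen, *The
Hardy–Littlewood–Chowla conjecture in the presence of a Siegel zero*, J. London Math. Soc. (2) 106
(2022), arXiv:2109.06291), **Proposition 7.1 (ii)**: "If … `1 ≤ a ≤ q ≤ x^{1/2+1/(50k)}`,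
`(a, q) ≤ H`, `I ⊂ [1, x]` …, and `f` is `q_χ`-periodic, then
`∑_{n ∈ I, n ≡ a (q)} Λ♭_Siegel(n) f((n-a)/q) ≪ (x/q)(…)`" with the proof "We can expand out
`ν(n) = ∑_{d ≤ R²} a_d 1_{d ∣ n}` for some weights `a_d = O(τ(d)^{O(1)}) = O(x^{ε²})`. For each
`d ≤ R²`, the constraints `n = a (q)`, `d ∣ n` are either inconsistent, or constrain `n` to a single
residue class `a' mod [q, d]` … The claim now follows from (i)".

Here (for `k = 2`): `prop71_ii`, in the explicit shape used by Proposition 7.2 — moduli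
`L ≤ 12 x^{1/2} R²`, `R ≤ x^{c/6}`, residues with `((a,L)+1)² ≤ x^{1/2}`, intervals in `[1, 2x]`,
bound `C ((a,L)+1)² x^{1-c}/L`. Everything is PROVED (from `prop71_i`).
  [cite: TaoTeravainen2021, Proposition 7.1 (ii)]
-/

noncomputable section

open Finset Real
open scoped ContDiff

namespace Literature.Barriers.Parity

namespace TaoTeravainen

open Literature.Analysis.Calculus

variable {q : ℕ}

/-- `ν(N) = ∑_{e,e' ∈ E} λ_e λ_{e'} 1_{e ∣ N} 1_{e' ∣ N}` for `N ≥ 1`. [cite: TaoTeravainen2021,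
§2.5 (2.14) and proof of Proposition 7.1 (ii) ("expand out `ν(n) = ∑_{d ≤ R²} a_d 1_{d∣n}`")] -/
theorem selbergSieve_eq_double_sum {ψ : ℝ → ℝ} (hψ : IsSmoothCutoff ψ) {R : ℝ} (hR : 1 < R)
    {N : ℕ} (hN : N ≠ 0) :
    selbergSieve ψ R N = ∑ e ∈ sieveRange R, ∑ e' ∈ sieveRange R,
      sieveWt ψ R e * sieveWt ψ R e' * (if e ∣ N ∧ e' ∣ N then 1 else 0) := by
  rw [selbergSieve_eq_sq hψ hR hN, sq, sum_mul_sum]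
  refine sum_congr rfl fun e _ => sum_congr rfl fun e' _ => ?_
  by_cases h1 : e ∣ N <;> by_cases h2 : e' ∣ N <;> simp [h1, h2]

/-- `#E ≤ R`. [folklore] -/
theorem card_sieveRange_le {R : ℝ} (hR : 0 ≤ R) : ((sieveRange R).card : ℝ) ≤ R := by
  rw [sieveRange, Nat.card_Ico]
  have h := Nat.ceil_lt_add_one hR
  rcases Nat.eq_zero_or_pos ⌈R⌉₊ with h0 | h0
  · rw [h0]; simpa using hR
  · rw [Nat.cast_sub h0]; push_cast; linarith

/-- **Proposition 7.1 (ii)** (`k = 2`): for `0 < ε₀ ≤ 1/100` there are `c > 0`, `C`, `x₀` such that for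
`x ≥ x₀`, `q_χ ≤ x^{1/20}`, any `χ (mod q_χ)`, `1 < R ≤ x^{c/6}`, moduli `1 ≤ L ≤ 12 x^{1/2} R²`, residues
`a` with `((a,L)+1)² ≤ x^{1/2}`, `1`-bounded `q_χ`-periodic `f`, and `[N₁, N₂] ⊆ [1, 2x]`,
`|∑_{N₁ ≤ N ≤ N₂, N ≡ a (L)} Λ♭_Siegel(N) f((N-a)/L)| ≤ C ((a,L)+1)² x^{1-c}/L`
(`Λ♭_Siegel = (χ∗log)♭ ν` with `X = log x`, `U₀ = log(D q_χ²)`, `D = x^{ε₀/20}`).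
[cite: TaoTeravainen2021, Proposition 7.1 (ii)] -/
theorem prop71_ii {φ ψ : ℝ → ℝ} (hφ : IsBump φ) (hψ : IsSmoothCutoff ψ) {ε₀ : ℝ} (hε₀ : 0 < ε₀)
    (hε₀1 : ε₀ ≤ 1 / 100) :
    ∃ c : ℝ, 0 < c ∧ ∃ C : ℝ, 0 ≤ C ∧ ∃ x₀ : ℝ, 1 ≤ x₀ ∧ ∀ x : ℝ, x₀ ≤ x →
      ∀ (q : ℕ) [NeZero q] (χ : DirichletCharacter ℂ q), (q : ℝ) ≤ x ^ (1 / 20 : ℝ) →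
      ∀ (R : ℝ), 1 < R → R ≤ x ^ (c / 6) →
      ∀ (L : ℕ), 0 < L → (L : ℝ) ≤ 12 * x ^ (1 / 2 : ℝ) * R ^ 2 →
      ∀ (a : ℤ), (((Int.gcd a L : ℕ) : ℝ) + 1) ^ 2 ≤ x ^ (1 / 2 : ℝ) →
      ∀ (f : ℤ → ℝ), (∀ k, |f k| ≤ 1) → (∀ k : ℤ, f (k + q) = f k) →
      ∀ (N₁ N₂ : ℕ), 1 ≤ N₁ → (N₂ : ℝ) ≤ 2 * x →
        |∑ N ∈ (Icc N₁ N₂).filter (fun N : ℕ => (N : ℤ) ≡ a [ZMOD L]),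
            vonMangoldtSiegelFlat χ φ ψ (Real.log x) (ε₀ / 20 * Real.log x + 2 * Real.log q) R N *
              f (((N : ℤ) - a) / L)| ≤
          C * (((Int.gcd a L : ℕ) : ℝ) + 1) ^ 2 * x ^ (1 - c) / L := by
  obtain ⟨c₁, hc₁, C₁, hC₁, x₁, hx₁, h71⟩ := prop71_i hφ hψ hε₀ hε₀1
  obtain ⟨Bψ, hBψ0, hBψ⟩ := hψ.exists_abs_le
  -- shrink `c₁`
  set c₂ : ℝ := min c₁ (1 / 100) with hc₂
  have hc₂pos : 0 < c₂ := lt_min hc₁ (by norm_num)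
  have hc₂le : c₂ ≤ c₁ := min_le_left _ _
  have hc₂s : c₂ ≤ 1 / 100 := min_le_right _ _
  -- the threshold for `12 R⁴ x^{1/2} ≤ x^{51/100}`: `12 ≤ x^{1/100 - c₂/3}`
  set x₂ : ℝ := (12 : ℝ) ^ (1 / (1 / 100 - c₂ / 3)) with hx₂
  refine ⟨c₂ / 2, by positivity, Bψ ^ 2 * C₁, by positivity, max x₁ (max x₂ 1),
    le_trans (le_max_right x₂ 1) (le_max_right _ _), ?_⟩
  intro x hx q _ χ hq R hR1 hRx L hL hLx a haL f hf1 hf N₁ N₂ hN₁ hN₂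
  have hxx₁ : x₁ ≤ x := le_trans (le_max_left _ _) hx
  have hxx₂ : x₂ ≤ x := le_trans (le_trans (le_max_left _ _) (le_max_right _ _)) hx
  have hx1 : 1 ≤ x := le_trans (le_trans (le_max_right _ _) (le_max_right _ _)) hx
  have hx0 : 0 < x := by linarith only [hx1]
  have hmono : ∀ a b : ℝ, a ≤ b → x ^ a ≤ x ^ b := fun a b h => Real.rpow_le_rpow_of_exponent_le hx1 h
  have hxadd : ∀ a b : ℝ, x ^ a * x ^ b = x ^ (a + b) := fun a b => (Real.rpow_add hx0 a b).symm
  have hxpos : ∀ a : ℝ, 0 < x ^ a := fun a => Real.rpow_pos_of_pos hx0 a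
  have hR0 : 0 < R := by linarith only [hR1]
  have hLr : (0 : ℝ) < L := by exact_mod_cast hL
  set g : ℕ := Int.gcd a L with hgdef
  set G : ℝ := ((g : ℕ) : ℝ) + 1 with hGdef
  have hG1 : 1 ≤ G := by rw [hGdef]; linarith only [(Nat.cast_nonneg g : (0 : ℝ) ≤ g)]
  set X : ℝ := Real.log x with hXdef
  set U₀ : ℝ := ε₀ / 20 * Real.log x + 2 * Real.log q with hU₀def
  -- `R⁴ ≤ x^{2c₂/3}`, `R⁶ ≤ x^{c₂/2}`
  have hRpow : ∀ n : ℕ, R ^ n ≤ x ^ ((n : ℝ) * (c₂ / 2 / 6)) := by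
    intro n
    calc R ^ n ≤ (x ^ (c₂ / 2 / 6)) ^ n := pow_le_pow_left₀ hR0.le hRx n
      _ = x ^ ((n : ℝ) * (c₂ / 2 / 6)) := by rw [← Real.rpow_natCast, ← Real.rpow_mul hx0.le, mul_comm]
  have hR4 : R ^ 4 ≤ x ^ (c₂ / 3) := by
    have := hRpow 4; refine this.trans (le_of_eq ?_); congr 1; push_cast; ring
  have hR6 : R ^ 6 ≤ x ^ (c₂ / 2) := by
    have := hRpow 6; refine this.trans (le_of_eq ?_); congr 1; push_cast; ring
  -- WLOG `N₁ ≤ N₂`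
  rcases lt_or_ge N₂ N₁ with hN | hN
  · have : (Icc N₁ N₂).filter (fun N : ℕ => (N : ℤ) ≡ a [ZMOD L]) = ∅ := by
      rw [Finset.Icc_eq_empty (by omega), Finset.filter_empty]
    rw [this, sum_empty, abs_zero]
    positivity
  -- expand `ν`
  have hexp : ∀ N ∈ (Icc N₁ N₂).filter (fun N : ℕ => (N : ℤ) ≡ a [ZMOD L]),
      vonMangoldtSiegelFlat χ φ ψ X U₀ R N * f (((N : ℤ) - a) / L) =
        ∑ e ∈ sieveRange R, ∑ e' ∈ sieveRange R, sieveWt ψ R e * sieveWt ψ R e' *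
          ((if e ∣ N ∧ e' ∣ N then (1 : ℝ) else 0) * (flatLog χ φ ψ X U₀ N * f (((N : ℤ) - a) / L))) := by
    intro N hN'
    rw [mem_filter, mem_Icc] at hN'
    unfold vonMangoldtSiegelFlat
    rw [selbergSieve_eq_double_sum hψ hR1 (by omega : N ≠ 0), mul_sum, sum_mul]
    refine sum_congr rfl fun e _ => ?_
    rw [mul_sum, sum_mul]
    refine sum_congr rfl fun e' _ => ?_
    ring
  rw [sum_congr rfl hexp, sum_comm]
  simp_rw [Finset.sum_comm (s := (Icc N₁ N₂).filter (fun N : ℕ => (N : ℤ) ≡ a [ZMOD L]))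
    (t := sieveRange R)]
  simp_rw [← mul_sum]
  -- the bound for one pair `(e, e')`
  have hpair : ∀ e ∈ sieveRange R, ∀ e' ∈ sieveRange R,
      |∑ N ∈ (Icc N₁ N₂).filter (fun N : ℕ => (N : ℤ) ≡ a [ZMOD L]),
        (if e ∣ N ∧ e' ∣ N then (1 : ℝ) else 0) * (flatLog χ φ ψ X U₀ N * f (((N : ℤ) - a) / L))| ≤
        C₁ * (G ^ 2 * R ^ 4) * x ^ (1 - c₂) / L := by
    intro e he e' he'
    rw [mem_sieveRange] at he he'
    set D : ℕ := Nat.lcm e e' with hDdef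
    have hD : 0 < D := Nat.lcm_pos he.1 he'.1
    have hDR : (D : ℝ) ≤ R ^ 2 := by
      have h1 : D ≤ e * e' := Nat.le_of_dvd (Nat.mul_pos he.1 he'.1) (Nat.lcm_dvd_mul e e')
      calc (D : ℝ) ≤ ((e * e' : ℕ) : ℝ) := by exact_mod_cast h1
        _ = (e : ℝ) * e' := by push_cast; ring
        _ ≤ R * R := mul_le_mul he.2.le he'.2.le (Nat.cast_nonneg _) hR0.le
        _ = R ^ 2 := (sq R).symm
    have hRHS0 : 0 ≤ C₁ * (G ^ 2 * R ^ 4) * x ^ (1 - c₂) / L := by positivity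
    -- the sum restricted to `e ∣ N`, `e' ∣ N`
    simp_rw [boole_mul]
    rw [← sum_filter, Finset.filter_filter]
    set T := (Icc N₁ N₂).filter (fun N : ℕ => (N : ℤ) ≡ a [ZMOD L] ∧ (e ∣ N ∧ e' ∣ N)) with hT
    rcases T.eq_empty_or_nonempty with hT0 | ⟨N₀, hN₀⟩
    · rw [hT0, sum_empty, abs_zero]; exact hRHS0
    rw [hT, mem_filter] at hN₀
    obtain ⟨hN₀I, hN₀a, hN₀e⟩ := hN₀
    have hN₀D : D ∣ N₀ := Nat.lcm_dvd hN₀e.1 hN₀e.2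
    set L' : ℕ := Nat.lcm L D with hL'def
    have hL' : 0 < L' := Nat.lcm_pos hL hD
    have hLL' : L ∣ L' := Nat.dvd_lcm_left _ _
    have hDL' : D ∣ L' := Nat.dvd_lcm_right _ _
    -- `T` is the class of `N₀` modulo `L'`
    have hclass : T = (Icc N₁ N₂).filter (fun N : ℕ => (N : ℤ) ≡ (N₀ : ℤ) [ZMOD L']) := by
      rw [hT]
      refine filter_congr fun N _ => ?_
      rw [← Nat.lcm_dvd_iff, ← hDdef]
      have hlcm : (Int.lcm (L : ℤ) (D : ℤ) : ℤ) = ((L' : ℕ) : ℤ) := by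
        rw [hL'def]; simp [Int.lcm]
      constructor
      · rintro ⟨h1, h2⟩
        have h3 : (N : ℤ) ≡ N₀ [ZMOD L] := h1.trans hN₀a.symm
        have h4 : (N : ℤ) ≡ N₀ [ZMOD D] :=
          (Int.modEq_zero_iff_dvd.mpr (Int.natCast_dvd_natCast.mpr h2)).trans
            (Int.modEq_zero_iff_dvd.mpr (Int.natCast_dvd_natCast.mpr hN₀D)).symm
        have := Int.modEq_and_modEq_iff_modEq_lcm.mp ⟨h3, h4⟩
        rwa [hlcm] at this
      · intro h
        rw [← hlcm] at h
        obtain ⟨h3, h4⟩ := Int.modEq_and_modEq_iff_modEq_lcm.mpr h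
        refine ⟨h3.trans hN₀a, ?_⟩
        have h5 : (D : ℤ) ∣ (N : ℤ) := by
          have := (Int.ModEq.dvd h4.symm)
          -- `D ∣ N - N₀` and `D ∣ N₀`
          have h6 : (D : ℤ) ∣ (N₀ : ℤ) := Int.natCast_dvd_natCast.mpr hN₀D
          have := Int.dvd_add this h6
          rwa [sub_add_cancel] at this
        exact Int.natCast_dvd_natCast.mp h5
    rw [hclass]
    -- the shifted periodic function
    set c₀ : ℤ := ((N₀ : ℤ) - a) / L with hc₀
    set f' : ℤ → ℝ := fun k => f (((L' / L : ℕ) : ℤ) * k + c₀) with hf'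
    have hf1' : ∀ k, |f' k| ≤ 1 := fun k => hf1 _
    have hf'' : ∀ k : ℤ, f' (k + q) = f' k := by
      intro k
      simp only [hf']
      rw [show (((L' / L : ℕ) : ℤ)) * (k + q) + c₀ = (((L' / L : ℕ) : ℤ) * k + c₀) + q * ((L' / L : ℕ) : ℤ) by ring]
      exact periodic_int_mul hf _ _
    have hfeq : ∀ N ∈ (Icc N₁ N₂).filter (fun N : ℕ => (N : ℤ) ≡ (N₀ : ℤ) [ZMOD L']),
        flatLog χ φ ψ X U₀ N * f (((N : ℤ) - a) / L) =
          flatLog χ φ ψ X U₀ N * f' (((N : ℤ) - N₀) / L') := by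
      intro N hN'
      rw [mem_filter] at hN'
      congr 1
      simp only [hf']
      congr 1
      -- `(N - a)/L = (L'/L) ((N - N₀)/L') + (N₀ - a)/L`
      obtain ⟨k, hk⟩ : (L' : ℤ) ∣ (N : ℤ) - N₀ := Int.ModEq.dvd hN'.2.symm
      have hLz : (L : ℤ) ≠ 0 := by exact_mod_cast hL.ne'
      have hL'z : (L' : ℤ) ≠ 0 := by exact_mod_cast hL'.ne'
      have h1 : ((N : ℤ) - N₀) / L' = k := by rw [hk, Int.mul_ediv_cancel_left _ hL'z]
      have hLL'eq : ((L' : ℕ) : ℤ) = (L : ℤ) * ((L' / L : ℕ) : ℤ) := by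
        rw [← Nat.cast_mul, Nat.mul_div_cancel' hLL']
      have h2 : ((N : ℤ) - a) = L * (((L' / L : ℕ) : ℤ) * k + c₀) := by
        have hLa : (L : ℤ) ∣ (N₀ : ℤ) - a := Int.ModEq.dvd hN₀a.symm
        have h3 : (L : ℤ) * c₀ = (N₀ : ℤ) - a := by rw [hc₀, Int.mul_ediv_cancel' hLa]
        calc ((N : ℤ) - a) = ((N : ℤ) - N₀) + ((N₀ : ℤ) - a) := by ring
          _ = (L' : ℤ) * k + (L : ℤ) * c₀ := by rw [hk, h3]
          _ = L * (((L' / L : ℕ) : ℤ) * k + c₀) := by rw [hLL'eq]; ring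
      rw [h2, Int.mul_ediv_cancel_left _ hLz, h1]
    rw [sum_congr rfl hfeq]
    -- apply Proposition 7.1 (i)
    have hL'x : (L' : ℝ) ≤ x ^ (51 / 100 : ℝ) := by
      have h1 : L' ≤ L * D := Nat.le_of_dvd (Nat.mul_pos hL hD) (Nat.lcm_dvd_mul L D)
      have h3x : (12 : ℝ) ≤ x ^ (1 / 100 - c₂ / 3) := by
        have hexp : 0 < 1 / 100 - c₂ / 3 := by linarith only [hc₂s]
        have h2 : x₂ ^ (1 / 100 - c₂ / 3) ≤ x ^ (1 / 100 - c₂ / 3) :=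
          Real.rpow_le_rpow (by positivity) hxx₂ hexp.le
        have h3 : x₂ ^ (1 / 100 - c₂ / 3) = 12 := by
          rw [hx₂, ← Real.rpow_mul (by norm_num), one_div_mul_cancel hexp.ne', Real.rpow_one]
        rw [h3] at h2; exact h2
      calc (L' : ℝ) ≤ ((L * D : ℕ) : ℝ) := by exact_mod_cast h1
        _ = (L : ℝ) * D := by push_cast; ring
        _ ≤ (12 * x ^ (1 / 2 : ℝ) * R ^ 2) * R ^ 2 := mul_le_mul hLx hDR (Nat.cast_nonneg _) (by positivity)
        _ = 12 * R ^ 4 * x ^ (1 / 2 : ℝ) := by ring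
        _ ≤ x ^ (1 / 100 - c₂ / 3) * x ^ (c₂ / 3) * x ^ (1 / 2 : ℝ) := by
            gcongr
        _ = x ^ (51 / 100 : ℝ) := by rw [hxadd, hxadd]; norm_num
    have hgcd' : ((Int.gcd (N₀ : ℤ) L' : ℕ) : ℝ) + 1 ≤ G * R ^ 2 := by
      -- `gcd(N₀, L') ≤ gcd(N₀, L) · D = g · D`
      have hgN₀ : Int.gcd (N₀ : ℤ) L = g := by
        rw [hgdef, ← Int.gcd_emod (N₀ : ℤ) L, ← Int.gcd_emod a L, hN₀a]
      set d := Int.gcd (N₀ : ℤ) L' with hd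
      have hd' : d = Nat.gcd N₀ L' := by rw [hd, Int.gcd_natCast_natCast]
      have hdvd : Nat.gcd N₀ L' ∣ Nat.gcd (Nat.gcd N₀ L') L * Nat.gcd (Nat.gcd N₀ L') D :=
        Nat.dvd_gcd_mul_gcd_iff_dvd_mul.mpr ((Nat.gcd_dvd_right _ _).trans (Nat.lcm_dvd_mul L D))
      have h1 : Nat.gcd (Nat.gcd N₀ L') L ≤ g := by
        have : Nat.gcd (Nat.gcd N₀ L') L ∣ Nat.gcd N₀ L :=
          Nat.dvd_gcd ((Nat.gcd_dvd_left _ _).trans (Nat.gcd_dvd_left _ _)) (Nat.gcd_dvd_right _ _)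
        have h2 : Nat.gcd N₀ L = g := by rw [← hgN₀, Int.gcd_natCast_natCast]
        rw [← h2]
        exact Nat.le_of_dvd (Nat.gcd_pos_of_pos_right _ hL) this
      have h2 : Nat.gcd (Nat.gcd N₀ L') D ≤ D := Nat.gcd_le_right _ hD
      have h3 : Nat.gcd N₀ L' ≤ g * D := by
        have hpos : 0 < Nat.gcd (Nat.gcd N₀ L') L * Nat.gcd (Nat.gcd N₀ L') D :=
          Nat.mul_pos (Nat.gcd_pos_of_pos_right _ hL) (Nat.gcd_pos_of_pos_right _ hD)
        exact (Nat.le_of_dvd hpos hdvd).trans (Nat.mul_le_mul h1 h2)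
      have h4 : (d : ℝ) ≤ g * R ^ 2 := by
        rw [hd']
        calc ((Nat.gcd N₀ L' : ℕ) : ℝ) ≤ ((g * D : ℕ) : ℝ) := by exact_mod_cast h3
          _ = (g : ℝ) * D := by push_cast; ring
          _ ≤ g * R ^ 2 := mul_le_mul_of_nonneg_left hDR (Nat.cast_nonneg _)
      have hR2 : 1 ≤ R ^ 2 := one_le_pow₀ hR1.le
      rw [hGdef]
      nlinarith only [h4, hR2, (Nat.cast_nonneg g : (0 : ℝ) ≤ g)]
    have hgcdx : (((Int.gcd (N₀ : ℤ) L' : ℕ) : ℝ) + 1) ^ 2 ≤ x := by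
      calc (((Int.gcd (N₀ : ℤ) L' : ℕ) : ℝ) + 1) ^ 2 ≤ (G * R ^ 2) ^ 2 :=
            pow_le_pow_left₀ (by positivity) hgcd' 2
        _ = G ^ 2 * R ^ 4 := by ring
        _ ≤ x ^ (1 / 2 : ℝ) * x ^ (c₂ / 3) := mul_le_mul haL hR4 (by positivity) (hxpos _).le
        _ = x ^ (1 / 2 + c₂ / 3) := hxadd _ _
        _ ≤ x ^ (1 : ℝ) := hmono _ _ (by linarith only [hc₂s])
        _ = x := Real.rpow_one x
    have h := h71 x hxx₁ q χ hq L' hL' hL'x (N₀ : ℤ) hgcdx f' hf1' hf'' N₁ N₂ hN₁ hN₂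
    refine h.trans ?_
    -- `C₁ (gcd+1)² x^{1-c₁}/L' ≤ C₁ (G R²)² x^{1-c₂}/L`
    have hL'L : (L : ℝ) ≤ L' := by exact_mod_cast Nat.le_of_dvd hL' hLL'
    have hx12 : x ^ (1 - c₁) ≤ x ^ (1 - c₂) := hmono _ _ (by linarith only [hc₂le])
    calc C₁ * (((Int.gcd (N₀ : ℤ) L' : ℕ) : ℝ) + 1) ^ 2 * x ^ (1 - c₁) / L'
        ≤ C₁ * (G * R ^ 2) ^ 2 * x ^ (1 - c₂) / L := by
          gcongr
      _ = C₁ * (G ^ 2 * R ^ 4) * x ^ (1 - c₂) / L := by ring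
  -- sum over the pairs
  have hcard := card_sieveRange_le hR0.le
  calc |∑ e ∈ sieveRange R, ∑ e' ∈ sieveRange R, sieveWt ψ R e * sieveWt ψ R e' *
        ∑ N ∈ (Icc N₁ N₂).filter (fun N : ℕ => (N : ℤ) ≡ a [ZMOD L]),
          (if e ∣ N ∧ e' ∣ N then (1 : ℝ) else 0) * (flatLog χ φ ψ X U₀ N * f (((N : ℤ) - a) / L))|
      ≤ ∑ e ∈ sieveRange R, ∑ e' ∈ sieveRange R, Bψ * Bψ * (C₁ * (G ^ 2 * R ^ 4) * x ^ (1 - c₂) / L) := by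
        refine (abs_sum_le_sum_abs _ _).trans (sum_le_sum fun e he => ?_)
        refine (abs_sum_le_sum_abs _ _).trans (sum_le_sum fun e' he' => ?_)
        rw [abs_mul, abs_mul]
        exact mul_le_mul (mul_le_mul (abs_sieveWt_le hBψ R e) (abs_sieveWt_le hBψ R e') (abs_nonneg _) hBψ0)
          (hpair e he e' he') (abs_nonneg _) (by positivity)
    _ = ((sieveRange R).card : ℝ) ^ 2 * (Bψ ^ 2 * C₁ * G ^ 2 * (R ^ 4 * x ^ (1 - c₂)) / L) := by
        rw [sum_const, sum_const, nsmul_eq_mul, nsmul_eq_mul]; ring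
    _ ≤ R ^ 2 * (Bψ ^ 2 * C₁ * G ^ 2 * (R ^ 4 * x ^ (1 - c₂)) / L) := by
        gcongr
    _ = Bψ ^ 2 * C₁ * G ^ 2 * (R ^ 6 * x ^ (1 - c₂)) / L := by ring
    _ ≤ Bψ ^ 2 * C₁ * G ^ 2 * (x ^ (c₂ / 2) * x ^ (1 - c₂)) / L := by gcongr
    _ = Bψ ^ 2 * C₁ * G ^ 2 * x ^ (1 - c₂ / 2) / L := by rw [hxadd]; congr 3; ring

end TaoTeravainen

end Literature.Barriers.Parity
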